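import Literature.Barriers.BirchSwinnertonDyer.RankNotSumOfLocalInvariantsProofs
import Mathlib.NumberTheory.NumberField.Cyclotomic.Galois
import Mathlib.NumberTheory.NumberField.InfinitePlace.Ramification
import Mathlib.RingTheory.Ideal.Int
import HarnessLib

/-!
# Barrier (BirchSwinnertonDyer): rank mod `5` is not a sum of local invariants — the field `F₅`

Companion to `Literature/Barriers/BirchSwinnertonDyer/RankNotSumOfLocalInvariantsProofs.lean`,
which reduces Theorem 2 of T. Dokchitser–V. Dokchitser, *A note on the Mordell–Weil rank modulo
`n`*, J. Number Theory 131 (2011) 1833–1839 (arXiv:0910.4588) to three named facts, one per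
`n ∈ {3, 4, 5}`. The `n = 5` fact
`Literature.Barriers.BirchSwinnertonDyer.DokchitserDokchitser2011_rank_480a1_F5` bundles three
printed claims about "`F₅` = the degree 25 subfield of `ℚ(ζ₁₁, ζ₂₄₁)`" (proof of Thm. 2, p. 3
of the arXiv copy): (i) such a field exists (Galois over `ℚ`, degree `25`, inside
`ℚ(ζ₂₆₅₁) = ℚ(ζ₁₁, ζ₂₄₁)`); (ii) "`F₅` also satisf[ies] the assumptions of Lemma 3 with
`n = 5`", i.e. the number of places of `F₅` above every place of `ℚ` is a multiple of `5`;
(iii) "2-descent shows that `rk E/F₅ = 1`" for `E = 480a1` ("e.g. using Magma, over all minimal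
non-trivial subfields of `F_n`").

This file CONSTRUCTS `F₅` and PROVES (i) and (ii); only the Magma computation (iii) remains, as
the sharper named fact `DokchitserDokchitser2011_mordellWeilRank_480a1_F5` (a statement about one
explicit number field), from which the bundled fact follows
(`DokchitserDokchitser2011_rank_480a1_F5_of_mordellWeilRank`). Source item → declaration
(namespace `Literature.Barriers.BirchSwinnertonDyer`, sub-namespace `DokchitserDokchitser2011`
for the objects of the paper) → status:

| source (DokchitserDokchitser2011RankModN, proof of Thm. 2) | declaration | status |
|---|---|---|
| "`F₅` = the degree 25 subfield of `ℚ(ζ₁₁, ζ₂₄₁)`" | `F5` (fixed field of the fifth powers of `Gal(ℚ(ζ₂₆₅₁)/ℚ) ≅ (ℤ/2651)ˣ`), `finrank_F5` (`= 25`), `isGalois_F5` | definition, proved |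
| "`F₅` satisfies the assumptions of Lemma 3 with `n = 5`", finite places | `five_dvd_ncard_primesOver_F5`, `five_dvd_natCard_heightOneSpectrum_F5` | proved |
| same, infinite place (`F₅` is totally real: `25` real places) | `natCard_infinitePlace_F5` | proved |
| "2-descent shows that `rk E/F₅ = 1`" (Magma) | `DokchitserDokchitser2011_mordellWeilRank_480a1_F5` | named fact — computer-assisted leaf (split review 2026-08-15: faithful, not Lean-dischargeable today; CERTIFIED by a complete `2`-descent 2026-08-16, kit job `j015461` — see its docstring) |
| the bundled `n = 5` computation | `DokchitserDokchitser2011_rank_480a1_F5_of_mordellWeilRank` | proved from the fact |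
| Thm. 2 for `n = 5` | `not_isSumOfLocalInvariants_rankInvariant_zmod_five` | proved from the fact |

How (ii) is proved. For a prime `p` let `e_K f_K` be ramification index times residue degree of
`p` in `K = ℚ(ζ₂₆₅₁)`, and `e f`, `g` those of `p` in `F₅` and the number of primes of `F₅`
above `p`. Mathlib's decomposition law in cyclotomic fields (Neukirch, ANT, Ch. I Prop. (10.3))
gives `e_K f_K = 10 · ord₂₄₁(11)`, `240 · ord₁₁(241)`, `ord₂₆₅₁(p)` for `p = 11`, `p = 241`,
`p ∤ 2651`; since `11⁴⁸ ≡ 1 (mod 241)` and `241² ≡ 1 (mod 11)` (`11` and `241` are fifth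
powers modulo one another — the `n = 5` analogue of the printed "13 and 103 are cubes modulo
one another"; the paper only says "Similarly `F₄` and `F₅` also satisfy the assumptions of
Lemma 3") and `(ℤ/2651)ˣ` has exponent `240`, always `e_K f_K ∣ 480`. By
multiplicativity in the tower `ℚ ⊂ F₅ ⊂ K`, `e f ∣ 480`, so `25 ∤ e f`, while
`g · e f = [F₅ : ℚ] = 25`; hence `g ∈ {5, 25}`. At infinity, `F₅/ℚ` is Galois of odd degree,
hence totally real: `25` places above `∞`. The degree `[F₅ : ℚ]` is the index of the fifth
powers in `(ℤ/2651)ˣ`, i.e. the number of solutions of `x⁵ = 1`, which is `5 · 5` by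
`ℤ/2651 ≅ ℤ/11 × ℤ/241` (`3` and `87` are primitive fifth roots of unity mod `11` and `241`).

Design notes. Everything about `F₅` is proved for an arbitrary `2651`-st cyclotomic extension
`K` of `ℚ` (`[IsCyclotomicExtension {2651} ℚ K]`, Mathlib style) and specialised to
`CyclotomicField 2651 ℚ` only in the last three declarations; there, and in `isGalois_F5`, the
option `backward.isDefEq.respectTransparency false` identifies the two `ℚ`-algebra structures on
a cyclotomic field / an intermediate field (`DivisionRing.toRatAlgebra` versus the structural
one), exactly as in Mathlib's `NumberTheory/NumberField/Cyclotomic/*.lean` and `FLT/Three.lean`.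
The rank leaf is not proved here (`WeierstrassCurve.mordellWeilRank = finrank ℤ E(F)`); the
printed value is a Magma `2`-descent over the six quintic subfields of `F₅`, and the leaf is a
statement about ONE explicit field. Later files reduce it further, all PROVED:
`RankNotSumOfLocalInvariantsF5Quintic.lean` (leaf `⇔` the six sharp quintic bounds
`rk E(F₅^⟨σ⟩) ≤ 1`, `σ ≠ 1`, by `C₅ × C₅` Galois descent and the rational point `(-1, 2)`),
`RankNotSumOfLocalInvariants480a1RankProofs.lean` (`rk E(ℚ) = 1`, the complete `2`-descent over
`ℚ` carried out in Lean on top of the tree's Mordell–Weil theorem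
`WeierstrassCurve.module_finite_point_holds`) and
`RankNotSumOfLocalInvariantsWeakSubfieldBoundsProofs.lean` (the WEAK bounds `rk E(F₅^⟨σ⟩) ≤ 4`
suffice, as `rk E(K) ≡ rk E(ℚ) (mod 4)` for `K/ℚ` cyclic quintic). What no file proves is any
`2`-descent over a number field `≠ ℚ`; see the docstring of the leaf for the split review
(2026-08-15) and the certificate route (twisted central `L`-values and Kato's theorem) recorded
there.

## References

* T. Dokchitser, V. Dokchitser, *A note on the Mordell–Weil rank modulo `n`*, J. Number Theory
  131 (2011) 1833–1839, arXiv:0910.4588: §1, Lemma 3 and the proof of Thm. 2 (p. 3 of the held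
  arXiv copy). [DokchitserDokchitser2011RankModN]
* J. Neukirch, *Algebraic Number Theory*, Grundlehren 322, Springer (1999): Ch. I, Prop. (10.3)
  (decomposition of primes in `ℚ(ζₙ)`: `e = φ(p^{ν_p})`, `f` = order of `p` modulo `n / p^{ν_p}`).
  [NeukirchANT1999]
-/

noncomputable section

open scoped NumberField

open NumberField IsDedekindDomain Ideal

namespace Literature.Barriers.BirchSwinnertonDyer

section General

variable (F : Type) [Field F] [NumberField F]

/-- `ℤ → 𝓞 ℚ` is surjective (indeed an isomorphism, Mathlib `Rat.ringOfIntegersEquiv`; any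
two ring maps out of `ℤ` agree). [folklore] -/
theorem algebraMap_int_ringOfIntegers_rat_surjective :
    Function.Surjective (algebraMap ℤ (𝓞 ℚ)) := by
  rw [show algebraMap ℤ (𝓞 ℚ) = Rat.ringOfIntegersEquiv.symm.toRingHom from Subsingleton.elim _ _]
  exact Rat.ringOfIntegersEquiv.symm.surjective

/-- **Finite places above `v` = primes over `v ∩ ℤ`.** For a number field `F` and a finite
place `v` of `ℚ` (a nonzero prime of `𝓞 ℚ`), the finite places `w` of `F` above `v`
(`w.under (𝓞 ℚ) = v`, as in Lemma 3 of Dokchitser–Dokchitser) are in bijection with the prime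
ideals of `𝓞 F` lying over the prime `v ∩ ℤ` of `ℤ` (Mathlib `Ideal.primesOver`), so their
number `Nat.card {w // w.under (𝓞 ℚ) = v}` is `#(v ∩ ℤ).primesOver (𝓞 F)` (uses `𝓞 ℚ ≅ ℤ`;
the `ℤ`-based variant of the tree's `Literature.NumberTheory.Automorphic.card_placesOver`,
restated here to keep the import closure small). [folklore] -/
theorem natCard_heightOneSpectrum_under_eq_ncard_primesOver (v : HeightOneSpectrum (𝓞 ℚ)) :
    Nat.card {w : HeightOneSpectrum (𝓞 F) // w.under (𝓞 ℚ) = v} =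
      ((v.asIdeal.under ℤ).primesOver (𝓞 F)).ncard := by
  have hv : v.asIdeal.under ℤ ≠ ⊥ := under_ne_bot ℤ v.ne_bot
  rw [← Nat.card_coe_set_eq]
  refine Nat.card_congr ⟨fun w => ⟨w.1.asIdeal, w.1.isPrime, ⟨?_⟩⟩,
    fun P => ⟨⟨P.1, P.2.1, ne_bot_of_mem_primesOver hv P.2⟩, ?_⟩, fun _ => rfl, fun _ => rfl⟩
  · rw [show v.asIdeal = (w.1.under (𝓞 ℚ)).asIdeal by rw [w.2],
      HeightOneSpectrum.under_asIdeal, under_under]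
  · have hP : P.1.under ℤ = v.asIdeal.under ℤ := P.2.2.over.symm
    ext1
    simp only [HeightOneSpectrum.under_asIdeal]
    refine Ideal.comap_injective_of_surjective _ algebraMap_int_ringOfIntegers_rat_surjective ?_
    change (P.1.under (𝓞 ℚ)).under ℤ = v.asIdeal.under ℤ
    rw [under_under, hP]

/-- **A Galois number field of odd degree has `[F : ℚ]` places above `∞`.** If `F/ℚ` is Galois
of odd degree then no infinite place of `F` ramifies (a ramified one has a decomposition group of
order `2`; Mathlib `IsUnramifiedAtInfinitePlaces_of_odd_finrank`), so `F` is totally real and the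
number of infinite places of `F` above the unique infinite place `v` of `ℚ` is `[F : ℚ]`.
[folklore] -/
theorem natCard_infinitePlace_comap_eq_finrank [IsGalois ℚ F] (hodd : Odd (Module.finrank ℚ F))
    (v : InfinitePlace ℚ) :
    Nat.card {w : InfinitePlace F // w.comap (algebraMap ℚ F) = v} = Module.finrank ℚ F := by
  haveI := IsUnramifiedAtInfinitePlaces_of_odd_finrank (k := ℚ) (K := F) hodd
  rw [Nat.card_congr (Equiv.subtypeUnivEquiv fun w => Subsingleton.elim _ _),
    Nat.card_eq_fintype_card, IsUnramifiedAtInfinitePlaces.card_infinitePlace ℚ F,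
    Fintype.card_unique, one_mul]

/-- Arithmetic of `g · (e f) = q²`: if `g · m = q ^ 2` for a prime `q` and `q² ∤ m`, then
`q ∣ g` (indeed `m ∈ {1, q}` and `g ∈ {q², q}`). [folklore] -/
theorem dvd_of_mul_eq_sq_of_not_sq_dvd {q g m : ℕ} (hq : q.Prime) (h : g * m = q ^ 2)
    (hm : ¬ q ^ 2 ∣ m) : q ∣ g := by
  obtain ⟨i, hi, rfl⟩ := (Nat.dvd_prime_pow hq).mp (Dvd.intro_left g h)
  interval_cases i
  · rw [pow_zero, mul_one] at h
    rw [h]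
    exact dvd_pow_self q two_ne_zero
  · rw [pow_one, sq] at h
    rw [mul_right_cancel₀ hq.ne_zero h]
  · exact absurd dvd_rfl hm

end General

namespace DokchitserDokchitser2011

/-- In `ℤ/p` (`p` prime) an element `ζ ≠ 1` with `ζ ^ k = 1`, `k` prime, is a primitive `k`-th
root of unity, so `ℤ/p` contains exactly `k` `k`-th roots of unity. [folklore] -/
theorem card_rootsOfUnity_zmod_of_prime {p : ℕ} (hp : p.Prime) {ζ : ZMod p} {k : ℕ}
    [Fact k.Prime] (h1 : ζ ^ k = 1) (h2 : ζ ≠ 1) : Nat.card (rootsOfUnity k (ZMod p)) = k := by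
  haveI := Fact.mk hp
  exact (IsPrimitiveRoot.iff_orderOf.mpr (orderOf_eq_prime h1 h2)).card_rootsOfUnity

/-- **`x⁵ = 1` has `25` solutions in `(ℤ/2651)ˣ`.** By the Chinese remainder theorem
`(ℤ/2651)ˣ ≅ (ℤ/11)ˣ × (ℤ/241)ˣ` (`2651 = 11 · 241`), and each factor contains exactly `5`
fifth roots of unity (`3⁵ ≡ 1 (mod 11)`, `87⁵ ≡ 1 (mod 241)`). Equivalently: the fifth powers
form a subgroup of index `25` of `(ℤ/2651)ˣ ≅ Gal(ℚ(ζ₂₆₅₁)/ℚ)`, whose fixed field is "the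
degree 25 subfield of `ℚ(ζ₁₁, ζ₂₄₁)`". [folklore] -/
theorem card_rootsOfUnity_five_zmod_2651 : Nat.card (rootsOfUnity 5 (ZMod 2651)) = 25 := by
  haveI : Fact (Nat.Prime 5) := ⟨by norm_num⟩
  have e : ZMod 2651 ≃+* ZMod 11 × ZMod 241 :=
    (ZMod.ringEquivCongr (by norm_num : 2651 = 11 * 241)).trans
      (ZMod.chineseRemainder (by norm_num))
  let φ : (ZMod 2651)ˣ ≃* (ZMod 11)ˣ × (ZMod 241)ˣ :=
    (Units.mapEquiv e.toMulEquiv).trans MulEquiv.prodUnits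
  have key : (rootsOfUnity 5 (ZMod 2651)) ≃
      (rootsOfUnity 5 (ZMod 11)) × (rootsOfUnity 5 (ZMod 241)) :=
    calc ↥(rootsOfUnity 5 (ZMod 2651))
      _ ≃ {y : (ZMod 11)ˣ × (ZMod 241)ˣ // y ^ 5 = 1} :=
          Equiv.subtypeEquiv φ.toEquiv (fun u => by
            rw [mem_rootsOfUnity]
            change u ^ 5 = 1 ↔ (φ u) ^ 5 = 1
            rw [← map_pow, MulEquiv.map_eq_one_iff])
      _ ≃ {y : (ZMod 11)ˣ × (ZMod 241)ˣ // y.1 ^ 5 = 1 ∧ y.2 ^ 5 = 1} :=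
          Equiv.subtypeEquivRight (fun y => by simp [Prod.ext_iff])
      _ ≃ {a : (ZMod 11)ˣ // a ^ 5 = 1} × {b : (ZMod 241)ˣ // b ^ 5 = 1} :=
          Equiv.subtypeProdEquivProd (p := fun a : (ZMod 11)ˣ => a ^ 5 = 1)
            (q := fun b : (ZMod 241)ˣ => b ^ 5 = 1)
      _ ≃ (rootsOfUnity 5 (ZMod 11)) × (rootsOfUnity 5 (ZMod 241)) :=
          Equiv.prodCongr (Equiv.subtypeEquivRight (fun a => (mem_rootsOfUnity 5 a).symm))
            (Equiv.subtypeEquivRight (fun a => (mem_rootsOfUnity 5 a).symm))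
  rw [Nat.card_congr key, Nat.card_prod,
    card_rootsOfUnity_zmod_of_prime (by norm_num) (ζ := 3) (by decide) (by decide),
    card_rootsOfUnity_zmod_of_prime (by norm_num) (ζ := 87) (by decide) (by decide)]

/-- **`(ℤ/2651)ˣ` has exponent dividing `240`** (the form used below): for a prime
`p ∤ 2651`, `p²⁴⁰ ≡ 1 (mod 2651)`, by the Chinese remainder theorem and Fermat's little theorem
modulo `11` and `241` (`10 ∣ 240`, `240 ∣ 240`). [folklore] -/
theorem natCast_pow_eq_one_zmod_2651 {p : ℕ} (hp : p.Prime) (h : ¬ p ∣ 2651) :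
    (p : ZMod 2651) ^ 240 = 1 := by
  haveI : Fact (Nat.Prime 11) := ⟨by norm_num⟩
  haveI : Fact (Nat.Prime 241) := ⟨by norm_num⟩
  have e : ZMod 2651 ≃+* ZMod 11 × ZMod 241 :=
    (ZMod.ringEquivCongr (by norm_num : 2651 = 11 * 241)).trans
      (ZMod.chineseRemainder (by norm_num))
  have hne : ∀ q : ℕ, q.Prime → q ∣ 2651 → (p : ZMod q) ≠ 0 := by
    intro q hq hqd hzero
    rw [ZMod.natCast_eq_zero_iff] at hzero
    exact h ((Nat.prime_dvd_prime_iff_eq hq hp).mp hzero ▸ hqd)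
  apply e.injective
  rw [map_pow, map_natCast, map_one, Prod.ext_iff]
  refine ⟨?_, ?_⟩
  · change ((p : ZMod 11 × ZMod 241) ^ 240).1 = 1
    rw [Prod.pow_fst, Prod.fst_natCast, show 240 = (11 - 1) * 24 by norm_num, pow_mul,
      ZMod.pow_card_sub_one_eq_one (hne 11 (by norm_num) (by norm_num)), one_pow]
  · change ((p : ZMod 11 × ZMod 241) ^ 240).2 = 1
    rw [Prod.pow_snd, Prod.snd_natCast, show 240 = 241 - 1 by norm_num,
      ZMod.pow_card_sub_one_eq_one (hne 241 (by norm_num) (by norm_num))]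

variable (K : Type) [Field K] [NumberField K] [IsCyclotomicExtension {2651} ℚ K]

/-- **Decomposition groups of `ℚ(ζ₂₆₅₁)/ℚ` have order dividing `480`.** For every prime
`p`, ramification index times residue degree of `p` in a `2651`-st cyclotomic extension `K/ℚ`
divides `480 = 2 · 240`: by the decomposition law in cyclotomic fields (`e = φ(p^{ν_p})`,
`f` = order of `p` modulo `2651 / p^{ν_p}`; Mathlib
`IsCyclotomicExtension.Rat.ramificationIdxIn_eq`, `inertiaDegIn_eq`, `…_eq_of_not_dvd`) one has
`e f = 10 · ord₂₄₁(11)` with `11⁴⁸ ≡ 1 (mod 241)` for `p = 11`, `e f = 240 · ord₁₁(241)` with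
`241² ≡ 1 (mod 11)` for `p = 241`, and `e f = ord₂₆₅₁(p) ∣ 240` otherwise
(`natCast_pow_eq_one_zmod_2651`). This (`11` and `241` are fifth powers modulo one another)
is the `n = 5` analogue of the printed "13 and 103 are cubes modulo one another" behind the
paper's "Similarly `F₄` and `F₅` also satisfy the assumptions of Lemma 3".
[cite: NeukirchANT1999, Ch. I Prop. (10.3)] -/
theorem ramificationIdxIn_mul_inertiaDegIn_dvd (p : ℕ) [hp : Fact p.Prime] :
    (span {(p : ℤ)}).ramificationIdxIn (𝓞 K) * (span {(p : ℤ)}).inertiaDegIn (𝓞 K) ∣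
      480 := by
  by_cases h11 : p = 11
  · subst h11
    rw [IsCyclotomicExtension.Rat.ramificationIdxIn_eq 2651 K
        (show 2651 = 11 ^ (0 + 1) * 241 by norm_num) (by norm_num),
      IsCyclotomicExtension.Rat.inertiaDegIn_eq 2651 K
        (show 2651 = 11 ^ (0 + 1) * 241 by norm_num) (by norm_num)]
    have h : orderOf (11 : ZMod 241) ∣ 48 := orderOf_dvd_of_pow_eq_one (by decide)
    exact (mul_dvd_mul_left _ h).trans (by norm_num)
  by_cases h241 : p = 241
  · subst h241
    rw [IsCyclotomicExtension.Rat.ramificationIdxIn_eq 2651 K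
        (show 2651 = 241 ^ (0 + 1) * 11 by norm_num) (by norm_num),
      IsCyclotomicExtension.Rat.inertiaDegIn_eq 2651 K
        (show 2651 = 241 ^ (0 + 1) * 11 by norm_num) (by norm_num)]
    have h : orderOf (241 : ZMod 11) ∣ 2 := orderOf_dvd_of_pow_eq_one (by decide)
    exact (mul_dvd_mul_left _ h).trans (by norm_num)
  · have hnd : ¬ p ∣ 2651 := by
      intro h
      rcases (Nat.Prime.dvd_mul hp.out).mp (show p ∣ 11 * 241 by simpa using h) with h' | h'
      · exact h11 ((Nat.prime_dvd_prime_iff_eq hp.out (by norm_num)).mp h')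
      · exact h241 ((Nat.prime_dvd_prime_iff_eq hp.out (by norm_num)).mp h')
    rw [IsCyclotomicExtension.Rat.ramificationIdxIn_eq_of_not_dvd p K hnd,
      IsCyclotomicExtension.Rat.inertiaDegIn_eq_of_not_dvd p K hnd, one_mul]
    exact (orderOf_dvd_of_pow_eq_one (natCast_pow_eq_one_zmod_2651 hp.out hnd)).trans
      (by norm_num)

/-- **The fifth powers in `Gal(K/ℚ)`**, `K` a `2651`-st cyclotomic extension of `ℚ`: the
subgroup corresponding to the fifth powers `{x⁵}` of `(ℤ/2651)ˣ` under Mathlib's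
`IsCyclotomicExtension.Rat.galEquivZMod : Gal(K/ℚ) ≃* (ℤ/2651)ˣ` (`σ ↦ a`, `σ ζ = ζ^a`). It
has index `25` (`card_rootsOfUnity_five_zmod_2651`), and is the unique subgroup of index `25`
(`(ℤ/2651)ˣ ≅ C₁₀ × C₂₄₀` has `5`-part `C₅ × C₅`), so its fixed field is "the degree 25
subfield of `ℚ(ζ₁₁, ζ₂₄₁)`" of the proof of Theorem 2.
[cite: DokchitserDokchitser2011RankModN, proof of Thm. 2] -/
def galFifthPowers : Subgroup Gal(K/ℚ) :=
  ((powMonoidHom 5 : (ZMod 2651)ˣ →* (ZMod 2651)ˣ).range).comap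
    (IsCyclotomicExtension.Rat.galEquivZMod 2651 K).toMonoidHom

/-- **The field `F₅` of Dokchitser–Dokchitser (2011), proof of Thm. 2**: "the degree 25 subfield
of `ℚ(ζ₁₁, ζ₂₄₁)`", realised inside a `2651`-st cyclotomic extension `K` of `ℚ`
(`ℚ(ζ₂₆₅₁) = ℚ(ζ₁₁, ζ₂₄₁)`, `2651 = 11 · 241`) as the fixed field of the fifth
powers of `Gal(K/ℚ) ≅ (ℤ/2651)ˣ` (`galFifthPowers`). It is Galois over `ℚ` with group `C₅ × C₅`
(`isGalois_F5`, `finrank_F5`). [cite: DokchitserDokchitser2011RankModN, proof of Thm. 2] -/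
def F5 : IntermediateField ℚ K :=
  IntermediateField.fixedField (galFifthPowers K)

/-- **`[F₅ : ℚ] = 25`**: by the Galois correspondence the degree of the fixed field is the index
of `galFifthPowers`, i.e. the index of the fifth powers in `(ℤ/2651)ˣ`, which is the number `25`
of fifth roots of unity in `ℤ/2651` (`card_rootsOfUnity_five_zmod_2651`).
[cite: DokchitserDokchitser2011RankModN, proof of Thm. 2] -/
theorem finrank_F5 : Module.finrank ℚ (F5 K) = 25 := by
  haveI := IsCyclotomicExtension.isGalois {2651} ℚ K
  rw [IntermediateField.finrank_eq_fixingSubgroup_index, F5,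
    IntermediateField.fixingSubgroup_fixedField, galFifthPowers,
    Subgroup.index_comap_of_surjective, Subgroup.index_range,
    ← rootsOfUnity_eq_ker, card_rootsOfUnity_five_zmod_2651]
  exact (IsCyclotomicExtension.Rat.galEquivZMod 2651 K).surjective

set_option backward.isDefEq.respectTransparency false in
/-- **`F₅/ℚ` is Galois** (every subfield of the abelian extension `K/ℚ` is; Mathlib
`IsCyclotomicExtension.isAbelianGalois`). [folklore] -/
theorem isGalois_F5 : IsGalois ℚ (F5 K) := by
  haveI := IsCyclotomicExtension.isAbelianGalois {2651} ℚ K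
  infer_instance

/-- **Every prime of `ℤ` has `5` or `25` primes above it in `F₅`** ("`F₅` also satisf[ies] the
assumptions of Lemma 3 with `n = 5`", finite places): for a prime `p`, with `g` the number of
primes of `𝓞 F₅` over `p` and `e`, `f` the (common) ramification index and residue degree,
`g · (e f) = [F₅ : ℚ] = 25` (Mathlib
`Ideal.ncard_primesOver_mul_ramificationIdxIn_mul_inertiaDegIn`) and `e f` divides
`e_K f_K ∣ 480` (tower `ℚ ⊂ F₅ ⊂ K`, Mathlib `Ideal.ramificationIdxIn_mul_ramificationIdxIn`,
`Ideal.inertiaDegIn_mul_inertiaDegIn`, and `ramificationIdxIn_mul_inertiaDegIn_dvd`), so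
`25 ∤ e f` and `5 ∣ g`.
[cite: DokchitserDokchitser2011RankModN, proof of Thm. 2] -/
theorem five_dvd_ncard_primesOver_F5 (p : ℕ) [hp : Fact p.Prime] :
    5 ∣ ((span {(p : ℤ)}).primesOver (𝓞 (F5 K))).ncard := by
  haveI := isGalois_F5 K
  haveI := IsCyclotomicExtension.isGalois {2651} ℚ K
  obtain ⟨⟨P, _, _⟩⟩ := (span {(p : ℤ)}).nonempty_primesOver (S := 𝓞 (F5 K))
  have hcard := ncard_primesOver_mul_ramificationIdxIn_mul_inertiaDegIn (span {(p : ℤ)})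
    (𝓞 (F5 K)) Gal((F5 K)/ℚ)
  rw [IsGalois.card_aut_eq_finrank, finrank_F5] at hcard
  refine dvd_of_mul_eq_sq_of_not_sq_dvd (q := 5) (by norm_num) hcard fun h25 => ?_
  have he := ramificationIdxIn_mul_ramificationIdxIn (p := span {(p : ℤ)}) P Gal((F5 K)/ℚ)
    (𝓞 K) Gal(K/ℚ) Gal(K/(F5 K))
  have hf := inertiaDegIn_mul_inertiaDegIn (span {(p : ℤ)}) P Gal((F5 K)/ℚ) (𝓞 K) Gal(K/ℚ)
    Gal(K/(F5 K))
  have hdvd : (span {(p : ℤ)}).ramificationIdxIn (𝓞 (F5 K)) *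
      (span {(p : ℤ)}).inertiaDegIn (𝓞 (F5 K)) ∣ 480 :=
    (mul_dvd_mul (Dvd.intro _ he) (Dvd.intro _ hf)).trans
      (ramificationIdxIn_mul_inertiaDegIn_dvd K p)
  exact absurd (h25.trans hdvd) (by norm_num)

/-- **The number of finite places of `F₅` above each finite place of `ℚ` is a multiple of `5`**
(the finite-place hypothesis of Lemma 3 for `F₅/ℚ`, `n = 5`, in the form used by
`DokchitserDokchitser2011_rank_480a1_F5`): the place `v` of `ℚ` is the prime `(p)`,
`p = N(v ∩ ℤ)`, and the places above it are the primes of `𝓞 F₅` over `(p)`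
(`natCard_heightOneSpectrum_under_eq_ncard_primesOver`, `five_dvd_ncard_primesOver_F5`).
[cite: DokchitserDokchitser2011RankModN, proof of Thm. 2] -/
theorem five_dvd_natCard_heightOneSpectrum_F5 (v : HeightOneSpectrum (𝓞 ℚ)) :
    5 ∣ Nat.card {w : HeightOneSpectrum (𝓞 (F5 K)) // w.under (𝓞 ℚ) = v} := by
  haveI : Fact (absNorm (v.asIdeal.under ℤ)).Prime := ⟨by
    haveI : NeZero v.asIdeal := ⟨v.ne_bot⟩
    exact Nat.absNorm_under_prime v.asIdeal⟩
  rw [natCard_heightOneSpectrum_under_eq_ncard_primesOver,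
    ← Int.ideal_span_absNorm_eq_self (v.asIdeal.under ℤ)]
  exact five_dvd_ncard_primesOver_F5 K _

/-- **`F₅` has `25` places above the infinite place of `ℚ`** (it is totally real: Galois of odd
degree `25` over `ℚ`; `natCard_infinitePlace_comap_eq_finrank`), in particular a multiple of `5`
(the infinite-place hypothesis of Lemma 3 for `F₅/ℚ`).
[cite: DokchitserDokchitser2011RankModN, proof of Thm. 2] -/
theorem natCard_infinitePlace_F5 (v : InfinitePlace ℚ) :
    Nat.card {w : InfinitePlace (F5 K) // w.comap (algebraMap ℚ (F5 K)) = v} = 25 := by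
  haveI := isGalois_F5 K
  rw [natCard_infinitePlace_comap_eq_finrank (F5 K) (by rw [finrank_F5]; decide), finrank_F5]

end DokchitserDokchitser2011

/-! ### The `n = 5` computation from the rank leaf -/

open DokchitserDokchitser2011

set_option backward.isDefEq.respectTransparency false in
/-- **Rank leaf, `n = 5`** (named fact; proof of Theorem 2 of Dokchitser–Dokchitser 2011):
"2-descent shows that `rk E/F₅ = 1`" ("e.g. using Magma, over all minimal non-trivial subfields
of `F_n`") for `E = 480a1 : y² = x(x+2)(x-3)` (`curve480a1`) and `F₅` = the degree-`25`
subfield of `ℚ(ζ₁₁, ζ₂₄₁)`, here the explicit field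
`DokchitserDokchitser2011.F5 (CyclotomicField 2651 ℚ)` (fixed field of the fifth powers of
`Gal(ℚ(ζ₂₆₅₁)/ℚ)`; proved above to be Galois of degree `25` with every place of `ℚ` below a
multiple of `5` places). Formally: `rank_ℤ E(F₅) = 1` for the tree's Mordell–Weil rank
(`WeierstrassCurve.mordellWeilRank = finrank ℤ E(F₅)`).
This is the only unproved ingredient of `DokchitserDokchitser2011_rank_480a1_F5`
(`DokchitserDokchitser2011_rank_480a1_F5_of_mordellWeilRank`).

Status (split review, 2026-08-15): a faithful and irreducible **computer-assisted** leaf. The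
printed value is a Magma `2`-descent "over all minimal non-trivial subfields" of `F₅`, i.e. six
`2`-Selmer computations over the cyclic quintic fields `F₅^⟨σ⟩` (`σ ≠ 1`; conductors `11`,
`241` and four of conductor `2651`): `S`-units and class groups of these quintic fields for
`S ∣ 30`, and the local images at the primes above `2, 3, 5` and at the five real places. No
Lean discharge is possible today: the tree has the Mordell–Weil theorem and a complete
`2`-descent over `ℚ` (`curve480a1.mordellWeilRank_eq_one : rk E(ℚ) = 1`,
`RankNotSumOfLocalInvariants480a1RankProofs.lean`), but no `2`-descent over a number field
`≠ ℚ` (no `S`-unit / class-group computation of a quintic field, no local image above `2` in an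
unramified quintic extension of `ℚ₂`). Proved reductions of this leaf: it is EQUIVALENT to the
six sharp bounds `rk E(F₅^⟨σ⟩) ≤ 1`
(`DokchitserDokchitser2011_mordellWeilRank_480a1_F5_iff_quintic`,
`RankNotSumOfLocalInvariantsF5Quintic.lean`) and already FOLLOWS from the weak bounds
`rk E(F₅^⟨σ⟩) ≤ 4`, i.e. `dim_𝔽₂ Sel₂(E/F₅^⟨σ⟩) ≤ 6`
(`DokchitserDokchitser2011_mordellWeilRank_480a1_F5_of_quintic_le_four`,
`RankNotSumOfLocalInvariantsWeakSubfieldBoundsProofs.lean`; `rk E(K) ≡ rk E(ℚ) (mod 4)` for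
`K/ℚ` cyclic quintic). Certificate route (independent of the printed `2`-descent; a numerical
computation plus a published theorem, not a Lean proof): for each quintic `K ⊂ F₅`,
`L(E/K, s) = L(E, s) · ∏_{χ ≠ 1} L(E, χ, s)` over the four non-trivial characters `χ` of
`Gal(K/ℚ)`, which are Dirichlet characters of order `5` modulo `2651 = 11 · 241` (the `24` such
characters are exactly the non-trivial characters of `Gal(F₅/ℚ) ≅ C₅ × C₅`, in six Galois
orbits, one per quintic subfield); if the `24` twisted central values `L(E, χ, 1)` are non-zero,
Kato's theorem (K. Kato, Astérisque 295 (2004), Cor. 14.3, p. 235: `L(E, χ, 1) ≠ 0 ⇒` the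
`χ`-part of `E(K)` is finite, for `K/ℚ` abelian; bib key `Kato2004Asterisque`) gives
`rk E(K) = rk E(ℚ) = 1` for all six `K`, hence the leaf by `…_of_quintic_le_four`. The split
review queued this computation (PARI/GP `lfuntwist`, together with PARI's `2`-descent `ellrank`
over `ℚ` and the class groups of the six quintic fields) as a harness compute job.

Outcome of the harness computations (2026-08-16; literature-prover seat of this fact, evidence
file `CERTIFICATE-480a1-F5.md` with logs and hashes). (a) ALGEBRAIC, the printed route: a
complete `2`-descent over each of the six quintic fields — PARI/GP 2.15.4; class numbers
`1, 1, 25, 25, 25, 25` (all ODD, so `K(S,2)` comes from `S`-units) with class groups and units made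
unconditional by `bnfcertify`; exact square-class maps (`nfeltval`, `nfmodpr`, `ideallog` modulo
squares in `(𝓞/v³)ˣ` above `2`, real signs) and local images at the primes above `2, 3, 5`
computed from explicit local points up to their theoretical size `#E(K_v)[2] · 2^{[K_v:ℚ₂]}`;
kit job `j015461`, validated over `ℚ` against `ellrank` (`dim Sel₂(E/ℚ) = 3`) and over the
conductor-`11` field against D. Simon's independent `bnfell2descent_complete` (job `j015442`) —
gives `dim_𝔽₂ Sel₂(E/F₅^⟨σ⟩) = 3`, i.e. the SHARP bound `rk E(F₅^⟨σ⟩) ≤ 1`, for all six fields: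
exactly the hypothesis of `DokchitserDokchitser2011_mordellWeilRank_480a1_F5_of_quintic` (the
descent via `2`-isogeny alone only gives `≤ 5`: `#S^{(φ')}(E'/K) = 2⁷`). (b) ANALYTIC: all `24`
twisted central values are numerically non-zero (min `|L(E, χ, 1)| ≈ 0.0343`, job `j015443`).
So the leaf holds as a certified computation, in agreement with the source; it stays a named
fact (there is no Lean proof: the class groups of the four conductor-`2651` quintics are beyond
any Minkowski-bound enumeration in Lean).
[cite: DokchitserDokchitser2011RankModN, proof of Thm. 2] -/
def DokchitserDokchitser2011_mordellWeilRank_480a1_F5 : Prop :=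
  (curve480a1.baseChange (F5 (CyclotomicField 2651 ℚ))).mordellWeilRank = 1

set_option backward.isDefEq.respectTransparency false in
/-- **The `n = 5` descent fact from its rank leaf.** Granting only the Magma value
`rk E/F₅ = 1` (`DokchitserDokchitser2011_mordellWeilRank_480a1_F5`), the bundled named fact
`DokchitserDokchitser2011_rank_480a1_F5` holds, witnessed by `F := F5 (CyclotomicField 2651 ℚ)`:
Galois over `ℚ` (`isGalois_F5`), of degree `25` (`finrank_F5`), a subfield of `ℚ(ζ₂₆₅₁)`
(the inclusion), with a multiple of `5` places above every finite
(`five_dvd_natCard_heightOneSpectrum_F5`) and infinite (`natCard_infinitePlace_F5`) place of `ℚ`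
— all PROVED here.
[cite: DokchitserDokchitser2011RankModN, proof of Thm. 2] -/
theorem DokchitserDokchitser2011_rank_480a1_F5_of_mordellWeilRank
    (h : DokchitserDokchitser2011_mordellWeilRank_480a1_F5) :
    DokchitserDokchitser2011_rank_480a1_F5 :=
  ⟨F5 (CyclotomicField 2651 ℚ), inferInstance, inferInstance,
    isGalois_F5 (CyclotomicField 2651 ℚ), finrank_F5 (CyclotomicField 2651 ℚ),
    ⟨(F5 (CyclotomicField 2651 ℚ)).val⟩,
    five_dvd_natCard_heightOneSpectrum_F5 (CyclotomicField 2651 ℚ),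
    fun v => (natCard_infinitePlace_F5 (CyclotomicField 2651 ℚ) v).symm ▸ ⟨5, rfl⟩, h⟩

set_option backward.isDefEq.respectTransparency false in
/-- **Theorem 2 of Dokchitser–Dokchitser (2011) for `n = 5`, from the rank leaf alone**: if
`rk E/F₅ = 1` for `E = 480a1` (`DokchitserDokchitser2011_mordellWeilRank_480a1_F5`), then the
Mordell–Weil rank modulo `5` is not a sum of local invariants — by Lemma 3
(`not_isSumOfLocalInvariants_rankInvariant_of_witness`) a local formula would give
`rk E/F₅ ≡ 0 (mod 5)`, but `1 ≢ 0`.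
[cite: DokchitserDokchitser2011RankModN, Thm. 2 (proof)] -/
theorem not_isSumOfLocalInvariants_rankInvariant_zmod_five
    (h : DokchitserDokchitser2011_mordellWeilRank_480a1_F5) :
    ¬ IsSumOfLocalInvariants (rankInvariant (ZMod 5)) := by
  haveI := isGalois_F5 (CyclotomicField 2651 ℚ)
  refine not_isSumOfLocalInvariants_rankInvariant_of_witness 5 (F5 (CyclotomicField 2651 ℚ))
    curve480a1 (five_dvd_natCard_heightOneSpectrum_F5 (CyclotomicField 2651 ℚ))
    (fun v => (natCard_infinitePlace_F5 (CyclotomicField 2651 ℚ) v).symm ▸ ⟨5, rfl⟩) ?_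
  have h1 : (curve480a1.baseChange (F5 (CyclotomicField 2651 ℚ))).mordellWeilRank = 1 := h
  rw [h1]
  decide

end Literature.Barriers.BirchSwinnertonDyer

end
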